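import Summits.NavierStokesRegularity.NavierStokesRegularity.Theorems.HardyPointSinkHardyEnergyBoundLedgerSliceIntegrals
import Summits.NavierStokesRegularity.NavierStokesRegularity.Theorems.HardyPointSinkHardyEnergyBoundLedgerTime
import Summits.NavierStokesRegularity.NavierStokesRegularity.Theorems.HardyPointSinkHardyEnergyBoundLedgerKato
import Literature.Analysis.FluidPDE.NSWave0
import HarnessLib

/-!
# Route HardyPointSink — `HardyEnergyBound`, line `birth`: the glue stub `stub_hardyLedger_of`

Item stmt-NavierStokesRegularity-7979 (crux `Theses.HardyPointSink.HardyEnergyBound`), registered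
skeleton `Cruxes/HardyEnergyBound/Lines/birth.lean`, stub `stub_hardyLedger_of`: the localised
point-sink identity (stub 2a), the solenoidal flux identity (stub 2b) and the space–time `L³` bound
(stub 2c) imply the LOCALISED HARDY LEDGER `H + D ≤ C + ofReal(−2I)` uniformly in the sink
`x₀ ∈ B(xs, R/4)` and the time `t ∈ [T − R², T)`.

Proof. Plateau cut-off `φ` (`= 1` on `B̄(xs,R/2)`, supported in `B(xs,R)`); identity 2a on the open
strip `(0,T)` between `T − R²` and `t`; the classical pressure is `Π[v s] + c(s)` a.e.
(`PressureNormalisationL3.pressure_ae_eq_rieszPressure_add_const` on `(0,S')`, `t < S' < T`), and by 2b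
the constant drops out of the right side, which becomes `Φ(s) − 2F(s)` with `F` the sharp influx and
`|Φ(s)| ≤ α + β∫|v(s)|³` (annulus terms: `|x − x₀| ≥ R/4`; Hölder–Stein for `|Π||v|`); 2c makes
`∫_{T−R²}^{T} ∫|v|³` finite. All time integrands are continuous on `[T − R², t]` (dominated
convergence; `c` through the `L^{3/2}`-continuity of `s ↦ Π[u s]`), so the interval integrals split,
and the `ℝ≥0∞` bookkeeping gives the ledger with `C = ofReal(sup-bound of H_φ(T−R²)) + ofReal(α)R² +
ofReal(β)∫∫|v|³`.
-/

noncomputable section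

open MeasureTheory Set Filter Topology Metric Function
open scoped ENNReal NNReal InnerProductSpace

set_option linter.dupNamespace false -- nested layout Summit.<S>.<Sub>, Sub = S (D-0017)

namespace Summit.NavierStokesRegularity.NavierStokesRegularity.Theorems

open Literature.Analysis.FluidPDE Literature.Analysis.PDE

/-! ### The sharp influx with the Riesz pressure, slice by slice -/

/-- On one slice: if `q = Π[w] + c` a.e. for continuous `w`, `q`, then
`∫_{B_R} flux_Π = ∫_{B_R} flux_q − c ∫_{B_R} ⟨w, x−x₀⟩/r³`. -/
theorem hardyEnergyBound_ledger_influx_eq {w : (EuclideanSpace ℝ (Fin 3)) → (EuclideanSpace ℝ (Fin 3))} (hw : Continuous w) {q : (EuclideanSpace ℝ (Fin 3)) → ℝ}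
    (hq : Continuous q) {c : ℝ} (hqc : ∀ᵐ x ∂(volume : Measure (EuclideanSpace ℝ (Fin 3))), q x = rieszPressure w x + c)
    (x₀ xs : (EuclideanSpace ℝ (Fin 3))) (R : ℝ) :
    ∫ x in ball xs R, hardyEnergyBound_ledgerFlux w (rieszPressure w) x₀ x =
      (∫ x in ball xs R, hardyEnergyBound_ledgerFlux w q x₀ x) -
        c * ∫ x in ball xs R, inner ℝ (w x) (x - x₀) / ‖x - x₀‖ ^ 3 := by
  have h1 : IntegrableOn (hardyEnergyBound_ledgerFlux w q x₀) (ball xs R) :=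
    hardyEnergyBound_ledger_integrableOn_ledgerFlux hw hq
  have h2 : IntegrableOn (fun x => c * (inner ℝ (w x) (x - x₀) / ‖x - x₀‖ ^ 3)) (ball xs R) :=
    (hardyEnergyBound_ledger_integrableOn_inner_div hw).const_mul c
  rw [← integral_const_mul, ← integral_sub h1 h2]
  refine integral_congr_ae ?_
  filter_upwards [ae_restrict_of_ae (s := ball xs R) hqc] with x hx
  simp only [hardyEnergyBound_ledgerFlux, hx]
  ring

/-- **The normalising constant is continuous in time.** If `p(s) = Π[v s] + c(s)` a.e. for every
`s` in a compact `K ⊆ (0, S')` and `p` is jointly smooth on `(0, T)`, then `c` is continuous on `K`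
(`c(s)|B̄| = ∫_{B̄} p(s) − ∫_{B̄} Π[v s]`). -/
theorem hardyEnergyBound_ledger_continuousOn_const {T ν : ℝ}
    {u₀ : EuclideanSpace ℝ (Fin 3) → EuclideanSpace ℝ (Fin 3)}
    {u v : ℝ → EuclideanSpace ℝ (Fin 3) → EuclideanSpace ℝ (Fin 3)} (hu : IsKatoSolutionOn T ν u₀ u)
    (hae : ∀ t ∈ Ioo 0 T, v t =ᵐ[volume] u t) {S' : ℝ} (hS'T : S' < T) {K : Set ℝ} (hK : K ⊆ Ioo 0 S')
    (hKc : IsCompact K)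
    {p : ℝ → (EuclideanSpace ℝ (Fin 3)) → ℝ} (hp : IsSmoothSpaceTimeOn (Ioo 0 T) p) {c : ℝ → ℝ}
    (hc : ∀ s ∈ K, ∀ᵐ x ∂(volume : Measure (EuclideanSpace ℝ (Fin 3))), p s x = rieszPressure (v s) x + c s)
    (xs : (EuclideanSpace ℝ (Fin 3))) {R : ℝ} (hR : 0 < R) : ContinuousOn c K := by
  have h32 : (1 : ℝ≥0∞) ≤ 3 / 2 :=
    ((ENNReal.lt_div_iff_mul_lt (Or.inl (by norm_num)) (Or.inl (by norm_num))).2 (by norm_num)).le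
  have hKT : K ⊆ Ioo 0 T := fun s hs => ⟨(hK hs).1, (hK hs).2.trans hS'T⟩
  set V : ℝ := (volume : Measure (EuclideanSpace ℝ (Fin 3))).real (closedBall xs R) with hV
  have hV0 : 0 < V := by
    rw [hV, measureReal_def]
    exact ENNReal.toReal_pos (measure_closedBall_pos volume xs hR).ne' measure_closedBall_lt_top.ne
  have hid : ∀ s ∈ K, c s = ((∫ x in closedBall xs R, p s x) -
      ∫ x in closedBall xs R, rieszPressure (v s) x) / V := fun s hs => by
    have hv3 : MemLp (v s) 3 volume := hardyEnergyBound_ledger_memLp_three hu hae (hKT hs)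
    have hPint : IntegrableOn (rieszPressure (v s)) (closedBall xs R) :=
      ((memLp_rieszPressure hv3).locallyIntegrable h32).integrableOn_isCompact (isCompact_closedBall xs R)
    have hcint : IntegrableOn (fun _ => c s) (closedBall xs R) := integrableOn_const measure_closedBall_lt_top.ne
    have h1 : ∫ x in closedBall xs R, p s x =
        (∫ x in closedBall xs R, rieszPressure (v s) x) + c s * V := by
      rw [integral_congr_ae (ae_restrict_of_ae (s := closedBall xs R) (hc s hs)), integral_add hPint hcint,
        setIntegral_const, smul_eq_mul, mul_comm]
    rw [h1]
    field_simp
    ring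
  have hcont : ContinuousOn (fun s => ((∫ x in closedBall xs R, p s x) -
      ∫ x in closedBall xs R, rieszPressure (v s) x) / V) K :=
    ((hardyEnergyBound_ledger_continuousOn_pressureMean hKc hKT hp).sub
      (hardyEnergyBound_ledger_continuousOn_rieszPressureMean hu hae hS'T hK xs R)).div_const V
  exact hcont.congr fun s hs => hid s hs

/-- **Stub `stub_hardyLedger_of` of line `birth` (crux `HardyEnergyBound`): the localised identity,
the solenoidal flux identity and the space–time `L³` bound imply the localised Hardy ledger.** -/
theorem stub_hardyLedger_of :
    (∀ (S : Set ℝ) (ν : ℝ) (v : ℝ → EuclideanSpace ℝ (Fin 3) → EuclideanSpace ℝ (Fin 3))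
      (p : ℝ → EuclideanSpace ℝ (Fin 3) → ℝ), IsOpen S →
      Literature.Analysis.FluidPDE.IsClassicalNSSolutionOn S ν 0 v p →
      ∀ (φ : EuclideanSpace ℝ (Fin 3) → ℝ), ContDiff ℝ (⊤ : ℕ∞) φ → HasCompactSupport φ →
      ∀ (x₀ : EuclideanSpace ℝ (Fin 3)) (t₁ t₂ : ℝ), t₁ ≤ t₂ → Set.Icc t₁ t₂ ⊆ S →
      (∫ x, φ x * ‖v t₂ x‖ ^ 2 / ‖x - x₀‖) - (∫ x, φ x * ‖v t₁ x‖ ^ 2 / ‖x - x₀‖)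
          + 2 * ν * (∫ s in t₁..t₂, ∫ x,
              φ x * Literature.Analysis.FluidPDE.frobeniusNormSq (fderiv ℝ (v s) x) / ‖x - x₀‖)
          + 4 * Real.pi * ν * φ x₀ * (∫ s in t₁..t₂, ‖v s x₀‖ ^ 2)
        = ∫ s in t₁..t₂, ∫ x,
            (ν * ‖v s x‖ ^ 2 * (Laplacian.laplacian φ x / ‖x - x₀‖
                - 2 * fderiv ℝ φ x (x - x₀) / ‖x - x₀‖ ^ 3)
              + (‖v s x‖ ^ 2 + 2 * p s x) * fderiv ℝ φ x (v s x) / ‖x - x₀‖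
              - 2 * φ x * (‖v s x‖ ^ 2 / 2 + p s x) * inner ℝ (v s x) (x - x₀) / ‖x - x₀‖ ^ 3)) →
    (∀ (v : EuclideanSpace ℝ (Fin 3) → EuclideanSpace ℝ (Fin 3)), ContDiff ℝ (⊤ : ℕ∞) v →
      Literature.Analysis.FluidPDE.VectorCalculus.IsDivFree v →
      ∀ (φ : EuclideanSpace ℝ (Fin 3) → ℝ), ContDiff ℝ (⊤ : ℕ∞) φ → HasCompactSupport φ →
      ∀ x₀ : EuclideanSpace ℝ (Fin 3),
      ∫ x, fderiv ℝ φ x (v x) / ‖x - x₀‖ = ∫ x, φ x * inner ℝ (v x) (x - x₀) / ‖x - x₀‖ ^ 3) →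
    (∀ ν : ℝ, 0 < ν → ∀ (T : ℝ) (u₀ : EuclideanSpace ℝ (Fin 3) → EuclideanSpace ℝ (Fin 3))
      (u : ℝ → EuclideanSpace ℝ (Fin 3) → EuclideanSpace ℝ (Fin 3)), 0 < T →
      Literature.Analysis.FluidPDE.IsKatoSolutionOn T ν u₀ u →
      ∀ (v : ℝ → EuclideanSpace ℝ (Fin 3) → EuclideanSpace ℝ (Fin 3))
        (p : ℝ → EuclideanSpace ℝ (Fin 3) → ℝ),
      Literature.Analysis.FluidPDE.IsClassicalNSSolutionOn (Set.Ioo 0 T) ν 0 v p →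
      (∀ t ∈ Set.Ioo 0 T, v t =ᵐ[MeasureTheory.volume] u t) →
      ∀ a : ℝ, 0 < a → a < T →
      ∫⁻ z in Set.Ioo a T ×ˢ (Set.univ : Set (EuclideanSpace ℝ (Fin 3))), ‖v z.1 z.2‖ₑ ^ (3 : ℝ) < ⊤) →
    ∀ ν : ℝ, 0 < ν → ∀ u₀ : EuclideanSpace ℝ (Fin 3) → EuclideanSpace ℝ (Fin 3),
      ContDiff ℝ (⊤ : ℕ∞) u₀ → Literature.Analysis.FluidPDE.NSWave0.IsDivFree u₀ →
      Literature.Analysis.FluidPDE.HasRapidSpatialDecay u₀ →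
      ∀ (T : ℝ) (u : ℝ → EuclideanSpace ℝ (Fin 3) → EuclideanSpace ℝ (Fin 3)), 0 < T →
      Literature.Analysis.FluidPDE.IsKatoSolutionOn T ν u₀ u →
      ∀ (v : ℝ → EuclideanSpace ℝ (Fin 3) → EuclideanSpace ℝ (Fin 3))
        (p : ℝ → EuclideanSpace ℝ (Fin 3) → ℝ),
      Literature.Analysis.FluidPDE.IsClassicalNSSolutionOn (Set.Ioo 0 T) ν 0 v p →
      (∀ t ∈ Set.Ioo 0 T, v t =ᵐ[MeasureTheory.volume] u t) →
      ∀ (xs : EuclideanSpace ℝ (Fin 3)) (R : ℝ), 0 < R → R ^ 2 < T →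
      ∃ C : NNReal, ∀ x₀ ∈ Metric.ball xs (R / 4), ∀ t ∈ Set.Ico (T - R ^ 2) T,
        (∫⁻ x in Metric.ball xs (R / 4), ‖v t x‖ₑ ^ 2 / ‖x - x₀‖ₑ)
          + (∫⁻ s in Set.Ioo (T - R ^ 2) t,
              (ENNReal.ofReal (2 * ν)
                  * (∫⁻ x in Metric.ball xs (R / 2),
                      ENNReal.ofReal (Literature.Analysis.FluidPDE.frobeniusNormSq (fderiv ℝ (v s) x))
                        / ‖x - x₀‖ₑ)
                + ENNReal.ofReal (4 * Real.pi * ν) * ‖v s x₀‖ₑ ^ 2))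
        ≤ (C : ENNReal)
          + ENNReal.ofReal (-2 * ∫ s in (T - R ^ 2)..t, ∫ x in Metric.ball xs R,
              (‖v s x‖ ^ 2 / 2 + Literature.Analysis.FluidPDE.rieszPressure (v s) x)
                * inner ℝ (v s x) (x - x₀) / ‖x - x₀‖ ^ 3) := by
  intro h₁ h₂ h₃ ν hν u₀ _hsm _hdiv _hdec T u hT hu v p hcl hae xs R hR hRT
  -- basic facts on the strip
  have hIoo : IsOpen (Ioo (0 : ℝ) T) := isOpen_Ioo
  have ha0 : 0 < T - R ^ 2 := by linarith
  have hsm_v : IsSmoothSpaceTimeOn (Ioo 0 T) v := hcl.smooth_velocity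
  have hsm_p : IsSmoothSpaceTimeOn (Ioo 0 T) p := hcl.smooth_pressure
  have hvc : ∀ s ∈ Ioo 0 T, Continuous (v s) := fun s hs => (hcl.contDiff_velocity hs).continuous
  have hpc : ∀ s ∈ Ioo 0 T, Continuous (p s) := fun s hs => (hcl.contDiff_pressure hs).continuous
  have hv3 : ∀ s ∈ Ioo 0 T, MemLp (v s) 3 volume := fun s hs =>
    hardyEnergyBound_ledger_memLp_three hu hae hs
  -- the cut-off and its constants
  obtain ⟨L₁, hL₁0, hL₁⟩ := hardyEnergyBound_ledger_exists_bound_fderiv_cutoff xs hR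
  obtain ⟨L₂, hL₂0, hL₂⟩ := hardyEnergyBound_ledger_exists_bound_laplacian_cutoff xs hR
  set φ := hardyEnergyBound_ledger_cutoff xs hR with hφ
  have hφs : ContDiff ℝ (⊤ : ℕ∞) φ := hardyEnergyBound_ledger_cutoff_contDiff xs hR
  have hφc : HasCompactSupport φ := hardyEnergyBound_ledger_cutoff_hasCompactSupport xs hR
  -- the constants of the bound
  set V : ℝ := (volume : Measure (EuclideanSpace ℝ (Fin 3))).real (closedBall xs R) with hV
  set Cst : ℝ := (steinConstThreeHalves : ℝ) with hCst
  have hV0 : 0 ≤ V := measureReal_nonneg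
  have hCst0 : 0 ≤ Cst := NNReal.coe_nonneg _
  set aA : ℝ := |ν| * (L₂ * (4 / R) + 2 * L₁ * (16 / R ^ 2)) with haA
  set aB : ℝ := 4 * L₁ / R * (1 + 2 * Cst) with haB
  set aD : ℝ := 16 / R ^ 2 * (1 / 2 + Cst) with haD
  have haA0 : 0 ≤ aA := by positivity
  have haB0 : 0 ≤ aB := by positivity
  have haD0 : 0 ≤ aD := by positivity
  set α : ℝ := aA * V with hα
  set β : ℝ := aA + aB + 2 * aD with hβ
  have hα0 : 0 ≤ α := by positivity
  have hβ0 : 0 ≤ β := by positivity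
  -- the initial weighted energy
  have ht0 : T - R ^ 2 ∈ Ioo 0 T := ⟨ha0, by nlinarith⟩
  obtain ⟨M₀, hM₀⟩ := (isCompact_closedBall xs R).exists_bound_of_continuousOn
    ((hvc (T - R ^ 2) ht0).continuousOn)
  set C₀ : ℝ := M₀ ^ 2 * (5 / 2 * (volume : Measure (EuclideanSpace ℝ (Fin 3))).real (ball 0 1) * R ^ 2)
    with hC₀
  -- the space–time `L³` bound
  have hfin : ∫⁻ s in Ioo (T - R ^ 2) T, ∫⁻ x, ‖v s x‖ₑ ^ 3 < ⊤ :=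
    hardyEnergyBound_ledger_lintegral_lintegral_lt_top
      (hsm_v.continuousOn.mono (prod_mono (Ioo_subset_Ioo_left ha0.le) Subset.rfl))
      (h₃ ν hν T u₀ u hT hu v p hcl hae (T - R ^ 2) ha0 (by nlinarith))
  set N : ℝ≥0∞ := ∫⁻ s in Ioo (T - R ^ 2) T, ∫⁻ x, ‖v s x‖ₑ ^ 3 with hN
  set C₁ : ℝ≥0∞ := ENNReal.ofReal α * ENNReal.ofReal (R ^ 2) + ENNReal.ofReal β * N with hC₁
  have hC₁top : C₁ ≠ ⊤ := ENNReal.add_ne_top.2 ⟨ENNReal.mul_ne_top ENNReal.ofReal_ne_top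
    ENNReal.ofReal_ne_top, ENNReal.mul_ne_top ENNReal.ofReal_ne_top hfin.ne⟩
  have hCtop : ENNReal.ofReal C₀ + C₁ ≠ ⊤ := ENNReal.add_ne_top.2 ⟨ENNReal.ofReal_ne_top, hC₁top⟩
  refine ⟨(ENNReal.ofReal C₀ + C₁).toNNReal, ?_⟩
  intro x₀ hx₀ t ht
  rw [ENNReal.coe_toNNReal hCtop]
  obtain ⟨ht1, htT⟩ := ht
  -- the time window `K = [T - R², t]` inside `(0, S')`, `S' = (t + T)/2`
  set S' : ℝ := (t + T) / 2 with hS'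
  have htS' : t < S' := by rw [hS']; linarith
  have hS'T : S' < T := by rw [hS']; linarith
  have hKT : Icc (T - R ^ 2) t ⊆ Ioo 0 T := fun s hs => ⟨ha0.trans_le hs.1, hs.2.trans_lt htT⟩
  have hKS' : Icc (T - R ^ 2) t ⊆ Ioo 0 S' := fun s hs => ⟨ha0.trans_le hs.1, hs.2.trans_lt htS'⟩
  have hKc : IsCompact (Icc (T - R ^ 2) t) := isCompact_Icc
  have hUI : uIcc (T - R ^ 2) t = Icc (T - R ^ 2) t := uIcc_of_le ht1
  -- pressure normalisation on `(0, S')`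
  have hcl' : IsClassicalNSSolutionOn (Ioo 0 S') ν 0 v p :=
    hcl.mono (Ioo_subset_Ioo_right hS'T.le) isOpen_Ioo.uniqueDiffOn
  obtain ⟨M, hM⟩ := (hu.continuousInLpOn.mono (fun s hs => ⟨hs.1, hs.2.trans_lt hS'T⟩ :
    Icc 0 S' ⊆ Ico 0 T)).exists_forall_eLpNorm_le_Icc
  have hMv : ∀ s ∈ Ioo 0 S', eLpNorm (v s) 3 volume ≤ M := fun s hs => by
    rw [eLpNorm_congr_ae (hae s ⟨hs.1, hs.2.trans hS'T⟩)]
    exact hM s ⟨hs.1.le, hs.2.le⟩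
  have hex : ∀ s, ∃ c : ℝ, s ∈ Ioo 0 S' →
      ∀ᵐ x ∂(volume : Measure (EuclideanSpace ℝ (Fin 3))), p s x = rieszPressure (v s) x + c := by
    intro s
    by_cases hs : s ∈ Ioo 0 S'
    · obtain ⟨c, hc⟩ := PressureNormalisationL3.pressure_ae_eq_rieszPressure_add_const hν.le hcl'
        (fun s hs => hv3 s ⟨hs.1, hs.2.trans hS'T⟩) hMv hs
      exact ⟨c, fun _ => hc⟩
    · exact ⟨0, fun h => absurd h hs⟩
  choose c hc using hex
  have hcK : ∀ s ∈ Icc (T - R ^ 2) t, ∀ᵐ x ∂(volume : Measure (EuclideanSpace ℝ (Fin 3))),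
      p s x = rieszPressure (v s) x + c s := fun s hs => hc s (hKS' hs)
  -- the solenoidal flux identity on each slice
  have hsol : ∀ s ∈ Ioo 0 T, ∫ x, fderiv ℝ φ x (v s x) / ‖x - x₀‖ =
      ∫ x, φ x * inner ℝ (v s x) (x - x₀) / ‖x - x₀‖ ^ 3 := fun s hs =>
    h₂ (v s) (hcl.contDiff_velocity hs) (hcl.divFree s hs) φ hφs hφc x₀
  -- the time functions
  set G : ℝ → ℝ := fun s => ∫ x, (hardyEnergyBound_ledgerA ν φ (v s) x₀ x +
    hardyEnergyBound_ledgerB φ (v s) (p s) x₀ x - hardyEnergyBound_ledgerC φ (v s) (p s) x₀ x) with hG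
  set F : ℝ → ℝ := fun s => ∫ x in ball xs R,
    hardyEnergyBound_ledgerFlux (v s) (rieszPressure (v s)) x₀ x with hF
  set Φ : ℝ → ℝ := fun s => (∫ x, hardyEnergyBound_ledgerA ν φ (v s) x₀ x) +
    (∫ x, hardyEnergyBound_ledgerB φ (v s) (rieszPressure (v s)) x₀ x) -
    2 * (∫ x in ball xs R, (φ x - 1) * hardyEnergyBound_ledgerFlux (v s) (rieszPressure (v s)) x₀ x)
    with hΦ
  set X : ℝ → ℝ := fun s => ∫ x, φ x * frobeniusNormSq (fderiv ℝ (v s) x) / ‖x - x₀‖ with hX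
  set Y : ℝ → ℝ := fun s => ‖v s x₀‖ ^ 2 with hY
  -- (1) slice by slice: `G = Φ - 2F` and `|Φ| ≤ α + β ∫|v s|³`
  have hGΦ : ∀ s ∈ Icc (T - R ^ 2) t, G s = Φ s - 2 * F s := fun s hs =>
    hardyEnergyBound_ledger_pressure_swap hR hx₀ hL₁0 hL₂0 hL₁ hL₂ (hvc s (hKT hs)) (hv3 s (hKT hs)) ν
      (hpc s (hKT hs)) (hcK s hs) (hsol s (hKT hs))
  have hΦb : ∀ s ∈ Icc (T - R ^ 2) t, |Φ s| ≤ α + β * ∫ x, ‖v s x‖ ^ 3 := fun s hs => by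
    have hw := hvc s (hKT hs)
    have hw3 := hv3 s (hKT hs)
    have h1 := hardyEnergyBound_ledger_abs_integral_ledgerA_le hR hx₀ hL₁0 hL₂0 hL₁ hL₂ hw hw3 ν
    have h2 := hardyEnergyBound_ledger_abs_integral_ledgerB_le hR hx₀ hL₁0 hL₁ hw hw3
    have h3 := hardyEnergyBound_ledger_abs_integral_deficit_le hR hx₀ hw hw3
    have hN0 : 0 ≤ ∫ x, ‖v s x‖ ^ 3 := integral_nonneg fun x => by positivity
    calc |Φ s| ≤ |∫ x, hardyEnergyBound_ledgerA ν φ (v s) x₀ x| +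
          |∫ x, hardyEnergyBound_ledgerB φ (v s) (rieszPressure (v s)) x₀ x| +
          2 * |∫ x in ball xs R, (φ x - 1) * hardyEnergyBound_ledgerFlux (v s) (rieszPressure (v s)) x₀ x| := by
          refine (abs_sub _ _).trans (add_le_add (abs_add_le _ _) ?_)
          rw [abs_mul, abs_two]
      _ ≤ aA * (V + ∫ x, ‖v s x‖ ^ 3) + aB * (∫ x, ‖v s x‖ ^ 3) + 2 * (aD * ∫ x, ‖v s x‖ ^ 3) :=
          add_le_add (add_le_add h1 h2) (mul_le_mul_of_nonneg_left h3 zero_le_two)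
      _ = α + β * ∫ x, ‖v s x‖ ^ 3 := by rw [hα, hβ]; ring
  -- (2) continuity in time on `K`
  have hGc : ContinuousOn G (Icc (T - R ^ 2) t) :=
    hardyEnergyBound_ledger_continuousOn_rhs hR hx₀ hL₁0 hL₂0 hL₁ hL₂ hKc hKT hsm_v hsm_p ν
  have hFc : ContinuousOn F (Icc (T - R ^ 2) t) := by
    have hcc : ContinuousOn c (Icc (T - R ^ 2) t) :=
      hardyEnergyBound_ledger_continuousOn_const hu hae hS'T hKS' hKc hsm_p hcK xs hR
    have h := (hardyEnergyBound_ledger_continuousOn_influx (x₀ := x₀) (xs := xs) (R := R) hKc hKT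
      hsm_v hsm_p).sub (hcc.mul (hardyEnergyBound_ledger_continuousOn_moment (x₀ := x₀) (xs := xs)
        (R := R) hKc hKT hsm_v))
    refine h.congr fun s hs => ?_
    exact hardyEnergyBound_ledger_influx_eq (hvc s (hKT hs)) (hpc s (hKT hs)) (hcK s hs) x₀ xs R
  have hXc : ContinuousOn X (Icc (T - R ^ 2) t) :=
    hardyEnergyBound_ledger_continuousOn_dissipation hR hIoo hKc hKT hsm_v
  have hYc : ContinuousOn Y (Icc (T - R ^ 2) t) :=
    ((hardyEnergyBound_ledger_continuousOn_timeLine (hsm_v.mono hKT) x₀).norm).pow 2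
  have hGi : IntervalIntegrable G volume (T - R ^ 2) t := (hGc.mono hUI.subset).intervalIntegrable
  have hFi : IntervalIntegrable F volume (T - R ^ 2) t := (hFc.mono hUI.subset).intervalIntegrable
  have hXi : IntervalIntegrable X volume (T - R ^ 2) t := (hXc.mono hUI.subset).intervalIntegrable
  have hYi : IntervalIntegrable Y volume (T - R ^ 2) t := (hYc.mono hUI.subset).intervalIntegrable
  -- (3) the identity between `T - R²` and `t`
  have hId : (∫ x, φ x * ‖v t x‖ ^ 2 / ‖x - x₀‖) - (∫ x, φ x * ‖v (T - R ^ 2) x‖ ^ 2 / ‖x - x₀‖) +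
      2 * ν * (∫ s in (T - R ^ 2)..t, X s) + 4 * Real.pi * ν * φ x₀ * (∫ s in (T - R ^ 2)..t, Y s) =
      ∫ s in (T - R ^ 2)..t, G s :=
    h₁ (Ioo 0 T) ν v p hIoo hcl φ hφs hφc x₀ (T - R ^ 2) t ht1 hKT
  have hφ1 : φ x₀ = 1 := hardyEnergyBound_ledger_cutoff_sink xs hR hx₀
  rw [hφ1, mul_one] at hId
  have hIG : (∫ s in (T - R ^ 2)..t, G s) + 2 * (∫ s in (T - R ^ 2)..t, F s) =
      ∫ s in (T - R ^ 2)..t, Φ s := by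
    rw [← intervalIntegral.integral_const_mul, ← intervalIntegral.integral_add hGi (hFi.const_mul 2)]
    refine intervalIntegral.integral_congr fun s hs => ?_
    rw [hUI] at hs
    simp only [hGΦ s hs]
    ring
  -- (4) the bound `ofReal ∫Φ ≤ C₁`
  have hΦe : ∀ s ∈ Icc (T - R ^ 2) t, ‖Φ s‖ₑ ≤ ENNReal.ofReal α + ENNReal.ofReal β * ∫⁻ x, ‖v s x‖ₑ ^ 3 :=
    fun s hs => by
    have hN0 : 0 ≤ ∫ x, ‖v s x‖ ^ 3 := integral_nonneg fun x => by positivity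
    rw [Real.enorm_eq_ofReal_abs, ← hardyEnergyBound_ledger_ofReal_integral_cube (hv3 s (hKT hs)),
      ← ENNReal.ofReal_mul hβ0, ← ENNReal.ofReal_add hα0 (mul_nonneg hβ0 hN0)]
    exact ENNReal.ofReal_le_ofReal (hΦb s hs)
  have hIΦ : ENNReal.ofReal (∫ s in (T - R ^ 2)..t, Φ s) ≤ C₁ := by
    rw [intervalIntegral.integral_of_le ht1]
    calc ENNReal.ofReal (∫ s in Ioc (T - R ^ 2) t, Φ s)
        ≤ ‖∫ s in Ioc (T - R ^ 2) t, Φ s‖ₑ := by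
          rw [Real.enorm_eq_ofReal_abs]; exact ENNReal.ofReal_le_ofReal (le_abs_self _)
      _ ≤ ∫⁻ s in Ioc (T - R ^ 2) t, ‖Φ s‖ₑ := enorm_integral_le_lintegral_enorm _
      _ ≤ ∫⁻ s in Ioc (T - R ^ 2) t, (ENNReal.ofReal α + ENNReal.ofReal β * ∫⁻ x, ‖v s x‖ₑ ^ 3) :=
          setLIntegral_mono' measurableSet_Ioc fun s hs => hΦe s (Ioc_subset_Icc_self hs)
      _ ≤ ∫⁻ s in Ioo (T - R ^ 2) T, (ENNReal.ofReal α + ENNReal.ofReal β * ∫⁻ x, ‖v s x‖ₑ ^ 3) :=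
          lintegral_mono_set (Ioc_subset_Ioo_right htT)
      _ = ENNReal.ofReal α * volume (Ioo (T - R ^ 2) T) + ENNReal.ofReal β * N := by
          rw [lintegral_add_left' aemeasurable_const, lintegral_const_mul' _ _ ENNReal.ofReal_ne_top,
            setLIntegral_const]
      _ = C₁ := by
          rw [hC₁, Real.volume_Ioo]
          congr 2
          congr 1
          ring
  -- (5) the Hardy energy and the dissipation against the weighted Bochner integrals
  have hH : (∫⁻ x in ball xs (R / 4), ‖v t x‖ₑ ^ 2 / ‖x - x₀‖ₑ) ≤
      ENNReal.ofReal (∫ x, φ x * ‖v t x‖ ^ 2 / ‖x - x₀‖) := by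
    have htI : t ∈ Ioo 0 T := hKT ⟨ht1, le_rfl⟩
    have h := hardyEnergyBound_ledger_setLIntegral_le_ofReal xs hR (by linarith : R / 4 ≤ R / 2)
      (g := fun x => ‖v t x‖ ^ 2) ((hvc t htI).norm.pow 2) (fun x => by positivity) x₀
    refine le_trans (le_of_eq (lintegral_congr fun x => ?_)) h
    rw [← ofReal_norm, ENNReal.ofReal_pow (norm_nonneg _)]
  have hX0 : ∀ s ∈ Icc (T - R ^ 2) t, 0 ≤ X s := fun s _ =>
    integral_nonneg fun x => div_nonneg (mul_nonneg (hardyEnergyBound_ledger_cutoff_nonneg xs hR x)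
      (frobeniusNormSq_nonneg _)) (norm_nonneg _)
  have hD : (∫⁻ s in Ioo (T - R ^ 2) t, (ENNReal.ofReal (2 * ν) *
      (∫⁻ x in ball xs (R / 2), ENNReal.ofReal (frobeniusNormSq (fderiv ℝ (v s) x)) / ‖x - x₀‖ₑ) +
      ENNReal.ofReal (4 * Real.pi * ν) * ‖v s x₀‖ₑ ^ 2)) ≤
      ENNReal.ofReal (2 * ν * (∫ s in (T - R ^ 2)..t, X s) + 4 * Real.pi * ν * (∫ s in (T - R ^ 2)..t, Y s)) := by
    have hZc : ContinuousOn (fun s => 2 * ν * X s + 4 * Real.pi * ν * Y s) (Icc (T - R ^ 2) t) :=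
      (continuousOn_const.mul hXc).add (continuousOn_const.mul hYc)
    have hZ0 : ∀ s ∈ Icc (T - R ^ 2) t, 0 ≤ 2 * ν * X s + 4 * Real.pi * ν * Y s := fun s hs =>
      add_nonneg (mul_nonneg (by positivity) (hX0 s hs)) (mul_nonneg (by positivity) (by positivity))
    have hZI : ∫ s in (T - R ^ 2)..t, (2 * ν * X s + 4 * Real.pi * ν * Y s) =
        2 * ν * (∫ s in (T - R ^ 2)..t, X s) + 4 * Real.pi * ν * (∫ s in (T - R ^ 2)..t, Y s) := by
      rw [intervalIntegral.integral_add (hXi.const_mul _) (hYi.const_mul _),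
        intervalIntegral.integral_const_mul, intervalIntegral.integral_const_mul]
    rw [← hZI, ← hardyEnergyBound_ledger_lintegral_Ioo_eq_ofReal ht1 hZc hZ0]
    refine setLIntegral_mono' measurableSet_Ioo fun s hs => ?_
    have hsK : s ∈ Icc (T - R ^ 2) t := Ioo_subset_Icc_self hs
    have hsI : s ∈ Ioo 0 T := hKT hsK
    have hfc : Continuous fun x => frobeniusNormSq (fderiv ℝ (v s) x) :=
      continuous_frobeniusNormSq_clm.comp
        ((hcl.contDiff_velocity hsI).continuous_fderiv (by simp))
    have h1 := hardyEnergyBound_ledger_setLIntegral_le_ofReal xs hR (le_refl (R / 2)) hfc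
      (fun x => frobeniusNormSq_nonneg _) x₀
    have h2 : ‖v s x₀‖ₑ ^ 2 = ENNReal.ofReal (Y s) := by
      rw [hY, ← ofReal_norm, ENNReal.ofReal_pow (norm_nonneg _)]
    rw [h2, ENNReal.ofReal_add (mul_nonneg (by positivity) (hX0 s hsK)) (by positivity),
      ENNReal.ofReal_mul (by positivity : (0 : ℝ) ≤ 2 * ν),
      ENNReal.ofReal_mul (by positivity : (0 : ℝ) ≤ 4 * Real.pi * ν)]
    exact add_le_add (mul_le_mul' le_rfl h1) le_rfl
  -- (6) the initial weighted energy
  have hE0 : ∫ x, φ x * ‖v (T - R ^ 2) x‖ ^ 2 / ‖x - x₀‖ ≤ C₀ :=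
    hardyEnergyBound_ledger_weightedEnergy_le xs hR hM₀ x₀
  -- (7) assembly
  have hHt0 : 0 ≤ ∫ x, φ x * ‖v t x‖ ^ 2 / ‖x - x₀‖ := integral_nonneg fun x =>
    div_nonneg (mul_nonneg (hardyEnergyBound_ledger_cutoff_nonneg xs hR x) (by positivity)) (norm_nonneg _)
  have hIX0 : 0 ≤ ∫ s in (T - R ^ 2)..t, X s :=
    intervalIntegral.integral_nonneg ht1 fun s hs => hX0 s hs
  have hIY0 : 0 ≤ ∫ s in (T - R ^ 2)..t, Y s :=
    intervalIntegral.integral_nonneg ht1 fun s _ => by positivity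
  have hD0 : 0 ≤ 2 * ν * (∫ s in (T - R ^ 2)..t, X s) + 4 * Real.pi * ν * (∫ s in (T - R ^ 2)..t, Y s) :=
    add_nonneg (mul_nonneg (by positivity) hIX0) (mul_nonneg (by positivity) hIY0)
  change _ ≤ (ENNReal.ofReal C₀ + C₁) + ENNReal.ofReal (-2 * ∫ s in (T - R ^ 2)..t, F s)
  have hkey : (∫ x, φ x * ‖v t x‖ ^ 2 / ‖x - x₀‖) +
      (2 * ν * (∫ s in (T - R ^ 2)..t, X s) + 4 * Real.pi * ν * (∫ s in (T - R ^ 2)..t, Y s)) ≤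
      C₀ + (∫ s in (T - R ^ 2)..t, Φ s) + (-2 * ∫ s in (T - R ^ 2)..t, F s) := by
    linarith [hId, hIG, hE0]
  calc (∫⁻ x in ball xs (R / 4), ‖v t x‖ₑ ^ 2 / ‖x - x₀‖ₑ) +
        (∫⁻ s in Ioo (T - R ^ 2) t, (ENNReal.ofReal (2 * ν) *
          (∫⁻ x in ball xs (R / 2), ENNReal.ofReal (frobeniusNormSq (fderiv ℝ (v s) x)) / ‖x - x₀‖ₑ) +
          ENNReal.ofReal (4 * Real.pi * ν) * ‖v s x₀‖ₑ ^ 2))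
      ≤ ENNReal.ofReal (∫ x, φ x * ‖v t x‖ ^ 2 / ‖x - x₀‖) +
        ENNReal.ofReal (2 * ν * (∫ s in (T - R ^ 2)..t, X s) +
          4 * Real.pi * ν * (∫ s in (T - R ^ 2)..t, Y s)) := add_le_add hH hD
    _ = ENNReal.ofReal ((∫ x, φ x * ‖v t x‖ ^ 2 / ‖x - x₀‖) +
        (2 * ν * (∫ s in (T - R ^ 2)..t, X s) + 4 * Real.pi * ν * (∫ s in (T - R ^ 2)..t, Y s))) :=
        (ENNReal.ofReal_add hHt0 hD0).symm
    _ ≤ ENNReal.ofReal (C₀ + (∫ s in (T - R ^ 2)..t, Φ s) + (-2 * ∫ s in (T - R ^ 2)..t, F s)) :=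
        ENNReal.ofReal_le_ofReal hkey
    _ ≤ ENNReal.ofReal (C₀ + (∫ s in (T - R ^ 2)..t, Φ s)) +
        ENNReal.ofReal (-2 * ∫ s in (T - R ^ 2)..t, F s) := ENNReal.ofReal_add_le
    _ ≤ (ENNReal.ofReal C₀ + ENNReal.ofReal (∫ s in (T - R ^ 2)..t, Φ s)) +
        ENNReal.ofReal (-2 * ∫ s in (T - R ^ 2)..t, F s) := add_le_add ENNReal.ofReal_add_le le_rfl
    _ ≤ (ENNReal.ofReal C₀ + C₁) + ENNReal.ofReal (-2 * ∫ s in (T - R ^ 2)..t, F s) :=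
        add_le_add (add_le_add le_rfl hIΦ) le_rfl

end Summit.NavierStokesRegularity.NavierStokesRegularity.Theorems

end
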